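import Literature.NumberTheory.EllipticCurves.CasselsTateThetaEvenLocal
import Literature.NumberTheory.EllipticCurves.CasselsTateSelfPairingLevel
import Literature.NumberTheory.EllipticCurves.CasselsTateFiniteSupport
import Literature.NumberTheory.EllipticCurves.WeilPairingProofs
import HarnessLib

/-!
# The Cassels–Tate pairing at level `m` is alternating: `⟨a, a⟩ = 0` at EVERY level (Cassels' theorem)

Topic `NumberTheory/EllipticCurves`; namespace `Literature.NumberTheory.EllipticCurves`.  Definitions with bodies
(the square-root pairing `sqrtPair`, the packaged `levelThetaDatumEven`) and theorems: **no named fact is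
introduced** (D-0026); same explicit inputs as `CasselsTateGeneralCase` / `CasselsTateSelfPairing` (`halt`,
`hPT' : inv.SumInvLocalizationEqZero`, `hH3`).

The tree proves `⟨a, a⟩ = 0` for the general case of Milne's construction of the Cassels–Tate pairing at
level `m` for ODD `m` (`CasselsTateSelfPairing.ctGeneralFun_self_eq_zero_of_odd`: `2⟨a,a⟩ = 0` and `2` is a
unit), and for ANY `m` from a theta group with a level structure (`CasselsTateSelfPairingLevel`,
`ctGeneralFun_self_eq_zero_of_levelThetaDatum`, after Morgan–Smith 2021 §5).  This file CONSTRUCTS that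
theta group at `l = 2` for EVEN `m` and concludes:

* `sqrtPair` — a square root of `e ∘ ([2] × [2])` on `E[2m²]`: the pairing `(x̃, ỹ) ↦ e(2x̃, 2ỹ)` is a power
  `w^c` of the Weil pairing `w = e_{2m²}` of the tree (`WeierstrassCurve.exists_pairing_eq_weilPairingFun_pow`),
  with `c` EVEN (`w(t, ·)` takes the value `−1` on a non-zero `2`-torsion point `t`, on which `e ∘ [2]` is
  trivial); `P = w^{c/2}` is alternating, bi-additive, equivariant, `P^{2m²} = 1`, `P² = e ∘ [2]`;
* `levelThetaDatumEven` — the `LevelThetaDatum W m e … 2` assembled from `thetaEven` / `levelEven`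
  (`CasselsTateThetaEven`) and the local isotropy `thetaEven_iso` (`CasselsTateThetaEvenLocal`);
* **`ctGeneralFun_self_eq_zero`** — `⟨a, a⟩ = 0` for the general-case Cassels–Tate pairing of the tree at
  EVERY level `m` (even: the theta group; odd: the tree's `ctGeneralFun_self_eq_zero_of_odd`) — the input
  `hct_alt` of `CasselsTateLevelAssembly.isLevelPairing_ctLevelPairing` is a THEOREM;
* `isLevelPairing_ctLevelPairing_of_inputs_alt` — the tree's `isLevelPairing_ctLevelPairing_of_inputs` with
  `hct_alt` (and `hfin`) discharged: the level-`m` Cassels–Tate pairing is a level pairing granted only the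
  `p`-generic duality inputs `hPT'`, `hH3`, `hPTc`, `h615`.

References: [Cassels1962ArithmeticIV] (alternation for elliptic curves); [MorganSmith2021CTP] §5 Thm. 5.10,
Def. 5.19, Prop. 5.24; [PoonenRains2012] §4.1; [MilneADT2006] I §6 Prop. 6.9, Rem. 6.10–6.11, Thm. 6.13(a);
[SilvermanAEC2009] III.8.1.  BSD is not proved by any of this.
-/

noncomputable section

open scoped Classical

universe u

namespace Literature.NumberTheory.EllipticCurves

open _root_.WeierstrassCurve Field Function NumberField
open Literature.NumberTheory.GaloisRepresentations Literature.NumberTheory.GaloisCohomology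
open Literature.NumberTheory.GaloisRepresentations.DiscreteGaloisModule (mu MuCarrier pairing)
open Literature.Algebra.Homology Literature.GroupTheory.FiniteAbelian
open scoped ContRepresentation

-- Cup products need `LocallyCompactSpace Γ`; as in the tree's cup-product files, the compactness of
-- absolute Galois groups is a local instance only.
attribute [local instance] absoluteGaloisGroup_compactSpace

-- `char K_v = 0` for the completions of a number field (the tree's theorem `charZero_placeCompletion`;
-- local instance, no override).
attribute [local instance] charZero_placeCompletion

section

variable {K : Type u} [Field K] [NumberField K] (W : WeierstrassCurve K) [W.IsElliptic] (m : ℕ) [NeZero m]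
variable (e : geomTorsion W ((m * m : ℕ) : ℤ) → geomTorsion W ((m * m : ℕ) : ℤ) → AlgebraicClosure K)
  (hμ : ∀ S T, e S T ^ (m * m) = 1)
  (hadd₁ : ∀ S₁ S₂ T, e (S₁ + S₂) T = e S₁ T * e S₂ T)
  (hadd₂ : ∀ S T₁ T₂, e S (T₁ + T₂) = e S T₁ * e S T₂)
  (hgal : ∀ (σ : absoluteGaloisGroup K) (S T : geomTorsion W ((m * m : ℕ) : ℤ)), σ • e S T = e (σ • S) (σ • T))
  (halt : ∀ T, e T T = 1)

/-! ### The square-root pairing on `E[2m²]` -/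

omit [W.IsElliptic] in
/-- `2m² ≠ 0` in `K`. [cite: SilvermanAEC2009, III.§8 (char F ∤ m)] -/
theorem two_mul_sq_ne_zero : ((2 * (m * m) : ℕ) : K) ≠ 0 :=
  Nat.cast_ne_zero.mpr (Nat.mul_ne_zero two_ne_zero (Nat.mul_ne_zero (NeZero.ne m) (NeZero.ne m)))

omit [NumberField K] [W.IsElliptic] [NeZero m] in
/-- Elements of `E[2m²]` are `2m²`-torsion geometric points. [cite: SilvermanAEC2009, III.§7 (the torsion subgroups E[m])] -/
theorem zsmul_coe_eq_zero (x : geomTorsion W ((2 * (m * m) : ℕ) : ℤ)) :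
    ((2 * (m * m) : ℕ) : ℤ) • (x : geomPoints W) = 0 :=
  (WeierstrassCurve.mem_geomTorsion_iff W _ _).mp x.2

/-- **The pulled-back pairing `(x̃, ỹ) ↦ e(2x̃, 2ỹ)` on `E[2m²]`.** [cite: MorganSmith2021CTP, §5.3 Def. 5.19 (the pairing P₀ ∘ (2 × 2))] -/
def sqPair (x y : geomTorsion W ((2 * (m * m) : ℕ) : ℤ)) : AlgebraicClosure K := e (mulK W 2 (m * m) x) (mulK W 2 (m * m) y)

include hμ hadd₁ hadd₂ halt in
/-- `e ∘ ([2] × [2]) = w^c` for the Weil pairing `w = e_{2m²}` of the tree and an EVEN exponent `c`: the pulled-back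
pairing is an alternating bi-additive `μ_{2m²}`-valued pairing on `E[2m²]`, hence a power `w^c`
(`exists_pairing_eq_weilPairingFun_pow`); on a non-zero `2`-torsion point `t` it is trivial while `w(t, ỹ) = −1`
for some `ỹ`, so `c` is even. [cite: SilvermanAEC2009, Prop. III.8.1 (the Weil pairing is alternating, non-degenerate, Galois equivariant)] -/
theorem exists_sqPair_eq_pow_two_mul : ∃ c : ℕ, ∀ x y : geomTorsion W ((2 * (m * m) : ℕ) : ℤ),
    sqPair W m e x y = weilPairingFun (two_mul_sq_ne_zero (K := K) m) (x : geomPoints W) (y : geomPoints W) ^ (2 * c) := by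
  have hN := two_mul_sq_ne_zero (K := K) m
  have mem := zsmul_coe_eq_zero W m
  -- `e ∘ [2]` as an alternating pairing with values `2m²`-th roots of unity
  have h1 : ∀ x y : geomTorsion W ((2 * (m * m) : ℕ) : ℤ), sqPair W m e x y ^ (2 * (m * m)) = 1 := fun x y => by
    rw [sqPair, pow_mul', hμ, one_pow]
  have h2 : ∀ x₁ x₂ y : geomTorsion W ((2 * (m * m) : ℕ) : ℤ),
      sqPair W m e (x₁ + x₂) y = sqPair W m e x₁ y * sqPair W m e x₂ y := fun x₁ x₂ y => by
    simp only [sqPair, map_add, hadd₁]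
  have h3 : ∀ x y₁ y₂ : geomTorsion W ((2 * (m * m) : ℕ) : ℤ),
      sqPair W m e x (y₁ + y₂) = sqPair W m e x y₁ * sqPair W m e x y₂ := fun x y₁ y₂ => by
    simp only [sqPair, map_add, hadd₂]
  have h4 : ∀ x : geomTorsion W ((2 * (m * m) : ℕ) : ℤ), sqPair W m e x x = 1 := fun x => halt _
  obtain ⟨c, hc⟩ := WeierstrassCurve.exists_pairing_eq_weilPairingFun_pow hN (sqPair W m e) h1 h2 h3 h4
  -- a non-zero `2`-torsion point `t`
  haveI : Finite (geomTorsion W (2 : ℤ)) := Nat.finite_of_card_ne_zero (by rw [natCard_two_torsion W]; norm_num)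
  obtain ⟨s, hs⟩ : ∃ s : geomTorsion W (2 : ℤ), s ≠ 0 := by
    by_contra h
    push Not at h
    have hsub : Subsingleton (geomTorsion W (2 : ℤ)) := ⟨fun a b => by rw [h a, h b]⟩
    have := natCard_two_torsion W
    rw [Nat.card_of_subsingleton (0 : geomTorsion W (2 : ℤ))] at this
    norm_num at this
  have hs2 : (2 : ℤ) • (s : geomPoints W) = 0 := (WeierstrassCurve.mem_geomTorsion_iff W _ _).mp s.2
  have htmem : (s : geomPoints W) ∈ geomTorsion W ((2 * (m * m) : ℕ) : ℤ) := by
    rw [WeierstrassCurve.mem_geomTorsion_iff, Nat.cast_mul, mul_comm, mul_smul, Nat.cast_ofNat, hs2, smul_zero]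
  set t : geomTorsion W ((2 * (m * m) : ℕ) : ℤ) := ⟨s, htmem⟩ with ht
  have ht0 : (t : geomPoints W) ≠ 0 := fun h0 => hs (Subtype.ext h0)
  -- `w(t, ỹ)² = 1` and `w(t, ỹ) = −1` for some `ỹ`
  have hsq : ∀ y : geomTorsion W ((2 * (m * m) : ℕ) : ℤ),
      weilPairingFun hN (t : geomPoints W) (y : geomPoints W) ^ 2 = 1 := fun y => by
    rw [← weilPairingFun_nsmul_left hN (mem t) (mem y)]
    have : (2 : ℕ) • (s : geomPoints W) = 0 := by rw [← natCast_zsmul]; exact hs2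
    change weilPairingFun hN ((2 : ℕ) • (s : geomPoints W)) (y : geomPoints W) = 1
    rw [this, weilPairingFun_zero_left hN (mem y)]
  have hex : ∃ y : geomTorsion W ((2 * (m * m) : ℕ) : ℤ), weilPairingFun hN (t : geomPoints W) (y : geomPoints W) = -1 := by
    by_contra h
    push Not at h
    have hall : ∀ y : geomTorsion W ((2 * (m * m) : ℕ) : ℤ), weilPairingFun hN (t : geomPoints W) (y : geomPoints W) = 1 :=
      fun y => by
        have hy2 := hsq y
        rw [pow_two] at hy2
        rcases mul_self_eq_one_iff.mp hy2 with h' | h'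
        · exact h'
        · exact absurd h' (h y)
    -- antisymmetry: `w(y, t) = 1` for all `y`, hence `t = 0`
    have hall' : ∀ S : geomPoints W, ((2 * (m * m) : ℕ) : ℤ) • S = 0 → weilPairingFun hN S (t : geomPoints W) = 1 := by
      intro S hS
      have h' := weilPairingFun_self hN (show ((2 * (m * m) : ℕ) : ℤ) • (S + (t : geomPoints W)) = 0 by
        rw [smul_add, hS, mem t, add_zero])
      rw [weilPairingFun_add_left hN hS (mem t) (by rw [smul_add, hS, mem t, add_zero]),
        weilPairingFun_add_right hN hS hS (mem t), weilPairingFun_add_right hN (mem t) hS (mem t),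
        weilPairingFun_self hN hS, weilPairingFun_self hN (mem t), hall ⟨S, (WeierstrassCurve.mem_geomTorsion_iff W _ _).mpr hS⟩,
        one_mul, mul_one, mul_one] at h'
      exact h'
    exact ht0 (eq_zero_of_weilPairingFun_eq_one hN (mem t) hall')
  obtain ⟨y, hy⟩ := hex
  -- hence `c` is even
  have hct := hc t y
  have htriv : sqPair W m e t y = 1 := by
    have h0 : mulK W 2 (m * m) t = 0 := by
      apply Subtype.ext
      rw [coe_mulK_apply, ZeroMemClass.coe_zero, Nat.cast_ofNat]
      exact hs2
    rw [sqPair, h0]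
    have := hadd₁ 0 0 (mulK W 2 (m * m) y)
    rw [add_zero] at this
    have hne : e 0 (mulK W 2 (m * m) y) ≠ 0 := fun hz => by
      have := hμ 0 (mulK W 2 (m * m) y)
      rw [hz, zero_pow (Nat.mul_ne_zero (NeZero.ne m) (NeZero.ne m))] at this
      exact zero_ne_one this
    exact (mul_eq_left₀ hne).mp this.symm
  rw [htriv, hy] at hct
  have heven : Even c := (neg_one_pow_eq_one_iff_even (by norm_num)).mp hct.symm
  obtain ⟨c', hc'⟩ := heven
  refine ⟨c', fun x y => ?_⟩
  rw [hc x y, hc', ← two_mul]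

/-- Half of the even exponent of `exists_sqPair_eq_pow_two_mul`. [cite: MorganSmith2021CTP, §5.3 Def. 5.19 (the pairing P₁ with P₁² = P₀ ∘ 2)] -/
def sqrtExp : ℕ := (exists_sqPair_eq_pow_two_mul W m e hμ hadd₁ hadd₂ halt).choose

/-- **The square-root pairing `P = w^{c/2}` on `E[2m²]`** (`P² = e ∘ ([2] × [2])`). [cite: MorganSmith2021CTP, §5.3 Def. 5.19 (the pairing P₁ with P₁² = P₀ ∘ 2)] -/
def sqrtPair (x y : geomTorsion W ((2 * (m * m) : ℕ) : ℤ)) : AlgebraicClosure K :=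
  weilPairingFun (two_mul_sq_ne_zero (K := K) m) (x : geomPoints W) (y : geomPoints W) ^ sqrtExp W m e hμ hadd₁ hadd₂ halt

/-- `P² = e ∘ ([2] × [2])`. [cite: MorganSmith2021CTP, §5.3 Def. 5.19 (the pairing P₁ with P₁² = P₀ ∘ 2)] -/
theorem sqrtPair_sq (x y : geomTorsion W ((2 * (m * m) : ℕ) : ℤ)) :
    sqrtPair W m e hμ hadd₁ hadd₂ halt x y ^ 2 = e (mulK W 2 (m * m) x) (mulK W 2 (m * m) y) := by
  have h := (exists_sqPair_eq_pow_two_mul W m e hμ hadd₁ hadd₂ halt).choose_spec x y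
  rw [sqPair] at h
  rw [h, sqrtPair, sqrtExp, ← pow_mul']

/-- `P^{2m²} = 1`. [cite: SilvermanAEC2009, Prop. III.8.1 (values of e_m in μ_m)] -/
theorem sqrtPair_pow (x y : geomTorsion W ((2 * (m * m) : ℕ) : ℤ)) :
    sqrtPair W m e hμ hadd₁ hadd₂ halt x y ^ (2 * (m * m)) = 1 := by
  rw [sqrtPair, ← pow_mul, pow_mul', weilPairingFun_pow _ (zsmul_coe_eq_zero W m x) (zsmul_coe_eq_zero W m y),
    one_pow]

/-- `P` is bi-additive (left). [cite: SilvermanAEC2009, Prop. III.8.1 (a)] -/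
theorem sqrtPair_add_left (x₁ x₂ y : geomTorsion W ((2 * (m * m) : ℕ) : ℤ)) :
    sqrtPair W m e hμ hadd₁ hadd₂ halt (x₁ + x₂) y =
      sqrtPair W m e hμ hadd₁ hadd₂ halt x₁ y * sqrtPair W m e hμ hadd₁ hadd₂ halt x₂ y := by
  simp only [sqrtPair, AddSubgroup.coe_add]
  rw [weilPairingFun_add_left _ (zsmul_coe_eq_zero W m x₁) (zsmul_coe_eq_zero W m x₂) (zsmul_coe_eq_zero W m y), mul_pow]

/-- `P` is bi-additive (right). [cite: SilvermanAEC2009, Prop. III.8.1 (a)] -/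
theorem sqrtPair_add_right (x y₁ y₂ : geomTorsion W ((2 * (m * m) : ℕ) : ℤ)) :
    sqrtPair W m e hμ hadd₁ hadd₂ halt x (y₁ + y₂) =
      sqrtPair W m e hμ hadd₁ hadd₂ halt x y₁ * sqrtPair W m e hμ hadd₁ hadd₂ halt x y₂ := by
  simp only [sqrtPair, AddSubgroup.coe_add]
  rw [weilPairingFun_add_right _ (zsmul_coe_eq_zero W m x) (zsmul_coe_eq_zero W m y₁) (zsmul_coe_eq_zero W m y₂), mul_pow]

/-- `P` is alternating. [cite: SilvermanAEC2009, Prop. III.8.1 (b)] -/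
theorem sqrtPair_self (x : geomTorsion W ((2 * (m * m) : ℕ) : ℤ)) : sqrtPair W m e hμ hadd₁ hadd₂ halt x x = 1 := by
  rw [sqrtPair, weilPairingFun_self _ (zsmul_coe_eq_zero W m x), one_pow]

/-- `P` is Galois equivariant. [cite: SilvermanAEC2009, Prop. III.8.1 (d)] -/
theorem sqrtPair_smul (σ : absoluteGaloisGroup K) (x y : geomTorsion W ((2 * (m * m) : ℕ) : ℤ)) :
    σ • sqrtPair W m e hμ hadd₁ hadd₂ halt x y = sqrtPair W m e hμ hadd₁ hadd₂ halt (σ • x) (σ • y) := by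
  rw [sqrtPair, sqrtPair, smul_pow', ← weilPairingFun_smul _ σ (zsmul_coe_eq_zero W m x) (zsmul_coe_eq_zero W m y)]
  rfl

/-! ### The level theta datum at `l = 2` for even `m` -/

/-- **The theta group with a level structure for `(E, m)` at `l = 2`, `m` even** (`LevelThetaDatum W m e … 2`):
the `μ_{m²}`-valued theta group `thetaEven` of the square-root pairing `P`, its level structure `levelEven` over
`E[2m]`, and the local isotropy `thetaEven_iso` — the instance required by the review of
`CasselsTateSelfPairingLevel`. [cite: MorganSmith2021CTP, §5 Thm. 5.10, Def. 5.19 and Prop. 5.24] -/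
def levelThetaDatumEven (hm : Even m) : LevelThetaDatum W m e hμ hadd₁ hadd₂ 2 where
  Θ := thetaEven W m (sqrtPair W m e hμ hadd₁ hadd₂ halt) (sqrtPair_pow W m e hμ hadd₁ hadd₂ halt)
    (sqrtPair_add_left W m e hμ hadd₁ hadd₂ halt) (sqrtPair_add_right W m e hμ hadd₁ hadd₂ halt)
    (sqrtPair_self W m e hμ hadd₁ hadd₂ halt) (sqrtPair_smul W m e hμ hadd₁ hadd₂ halt)
  ρ_eq σ x := rfl
  α_eq σ z := rfl
  commForm_eq x y := by
    rw [muCarrier_eq_iff, coe_weilPairingHom]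
    exact (coe_thetaEven_commForm W m _ _ _ _ _ _ x y).trans (sqrtPair_sq W m e hμ hadd₁ hadd₂ halt x y)
  continuous_χ x := continuous_thetaEven_χ W m _ _ _ _ _ _ x
  L := levelEven W m (sqrtPair W m e hμ hadd₁ hadd₂ halt) (sqrtPair_pow W m e hμ hadd₁ hadd₂ halt)
    (sqrtPair_add_left W m e hμ hadd₁ hadd₂ halt) (sqrtPair_add_right W m e hμ hadd₁ hadd₂ halt)
    (sqrtPair_self W m e hμ hadd₁ hadd₂ halt) (sqrtPair_smul W m e hμ hadd₁ hadd₂ halt) hm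
  mem_M₀ x hx := hx
  iso v κ hκ := thetaEven_iso W m (sqrtPair W m e hμ hadd₁ hadd₂ halt) (sqrtPair_pow W m e hμ hadd₁ hadd₂ halt)
    (sqrtPair_add_left W m e hμ hadd₁ hadd₂ halt) (sqrtPair_add_right W m e hμ hadd₁ hadd₂ halt)
    (sqrtPair_self W m e hμ hadd₁ hadd₂ halt) (sqrtPair_smul W m e hμ hadd₁ hadd₂ halt) v κ hκ

/-! ### `⟨a, a⟩ = 0` at every level -/

variable {W m e hμ hadd₁ hadd₂ hgal}
variable (inv : LocalInvariants K (m * m)) (hPT' : inv.SumInvLocalizationEqZero)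
  (hH3 : ∀ c : galoisCohomology (mu K (m * m)) 3,
    (∀ v : Place K, galoisCohomology.localization (mu K (m * m)) v 3 c = 0) → c = 0)
include halt hPT' hH3

/-- **`⟨a, a⟩ = 0` at EVEN level** `m`: the general-case Cassels–Tate pairing of the tree is alternating on `Ш[m]`
for even `m`, by `ctGeneralFun_self_eq_zero_of_levelThetaDatum` and the constructed `levelThetaDatumEven`.
[cite: Cassels1962ArithmeticIV, §1 (the pairing on Ш of an elliptic curve is alternating)] -/
theorem ctGeneralFun_self_eq_zero_of_even (hm : Even m) {a : W.galH1} (ha : a ∈ W.sha) (hma : (m : ℤ) • a = 0) :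
    ctGeneralFun W m e hμ hadd₁ hadd₂ hgal inv a a = 0 :=
  ctGeneralFun_self_eq_zero_of_levelThetaDatum inv halt hPT' hH3
    (localTerm_finite_support W m e hμ hadd₁ hadd₂ hgal halt inv) (levelThetaDatumEven W m e hμ hadd₁ hadd₂ halt hm) ha hma

/-- **Cassels' theorem for the tree's pairing: `⟨a, a⟩ = 0` at EVERY level `m`** — even `m` by the theta group,
odd `m` by `2⟨a, a⟩ = 0` (`ctGeneralFun_self_eq_zero_of_odd`).  This is the input `hct_alt` of
`CasselsTateLevelAssembly.isLevelPairing_ctLevelPairing`, now a theorem. [cite: Cassels1962ArithmeticIV, §1 (the pairing on Ш of an elliptic curve is alternating)] -/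
theorem ctGeneralFun_self_eq_zero {a : W.galH1} (ha : a ∈ W.sha) (hma : (m : ℤ) • a = 0) :
    ctGeneralFun W m e hμ hadd₁ hadd₂ hgal inv a a = 0 := by
  rcases Nat.even_or_odd m with hm | hm
  · exact ctGeneralFun_self_eq_zero_of_even halt inv hPT' hH3 hm ha hma
  · exact ctGeneralFun_self_eq_zero_of_odd inv halt hPT' hH3 (localTerm_finite_support W m e hμ hadd₁ hadd₂ hgal halt inv)
      hm ha hma

/-- **The level-`m` Cassels–Tate pairing is a level pairing, alternation and finite support discharged**: the tree's
`isLevelPairing_ctLevelPairing_of_inputs` with `hct_alt := ctGeneralFun_self_eq_zero`.  Remaining inputs: `halt`,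
`hPT'` (reciprocity for `H²(K, μ_{m²})`), `hH3` (`Ш³(K, μ_{m²}) = 0`), `hPTc` (Poitou–Tate for `Ш²(K, E[m])`) and
`h615` (Lemma 6.15) — all `p`-generic. [cite: MilneADT2006, Ch. I §6, Thm. 6.13(a)] -/
theorem isLevelPairing_ctLevelPairing_of_inputs_alt
    (hPTc : ∀ f : contTwoCocycles (W.torsionGaloisModule (m : ℤ)).toTopRep,
      (∀ g : contOneCocycles (W.torsionGaloisModule (m : ℤ)).toTopRep,
        (∀ v : Place K, locClass (W.torsionGaloisModule (m : ℤ)) (Place.Completion v)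
          (resOne (W.torsionGaloisModule (m : ℤ)) (Place.Completion v) g) = 0) →
        ∃ (C : PTChoice W m e hμ hadd₁ hadd₂ hgal f g) (S : Finset (Place K)),
          (∀ v ∉ S, C.localTerm inv v = 0) ∧ ∑ v ∈ S, C.localTerm inv v = 0) →
      twoCocycleClass _ f = 0)
    (S₀ : Finset (Place K))
    (h615 : ∀ S : Finset (Place K), S₀ ⊆ S → ∀ x : LocalClasses W m S,
      (∀ b' ∈ selmerGroup W (m : ℤ), sumPairing W m e hμ hadd₁ hadd₂ hgal inv S x (locS W m S b') = 0) →
        ∃ b₀ ∈ kummerOutside W m S, ∀ v : S,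
          x v - locS W m S b₀ v ∈ W.kummerLocalConditionAt (m : ℤ) (Place.Completion (v : Place K))) :
    IsLevelPairing m (ctLevelPairing W m e hμ hadd₁ hadd₂ hgal inv halt hPT' hH3
      (localTerm_finite_support W m e hμ hadd₁ hadd₂ hgal halt inv)) :=
  isLevelPairing_ctLevelPairing_of_inputs W m e hμ hadd₁ hadd₂ hgal inv halt hPT' hH3 hPTc S₀ h615
    fun _ ha hma => ctGeneralFun_self_eq_zero halt inv hPT' hH3 ha hma

/-- **Existence form at level `m`**, alternation and finite support discharged (the tree's
`exists_isLevelPairing_of_inputs` without `hct_alt`). [cite: MilneADT2006, Ch. I §6, Thm. 6.13(a)] -/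
theorem exists_isLevelPairing_of_inputs_alt
    (hPTc : ∀ f : contTwoCocycles (W.torsionGaloisModule (m : ℤ)).toTopRep,
      (∀ g : contOneCocycles (W.torsionGaloisModule (m : ℤ)).toTopRep,
        (∀ v : Place K, locClass (W.torsionGaloisModule (m : ℤ)) (Place.Completion v)
          (resOne (W.torsionGaloisModule (m : ℤ)) (Place.Completion v) g) = 0) →
        ∃ (C : PTChoice W m e hμ hadd₁ hadd₂ hgal f g) (S : Finset (Place K)),
          (∀ v ∉ S, C.localTerm inv v = 0) ∧ ∑ v ∈ S, C.localTerm inv v = 0) →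
      twoCocycleClass _ f = 0)
    (S₀ : Finset (Place K))
    (h615 : ∀ S : Finset (Place K), S₀ ⊆ S → ∀ x : LocalClasses W m S,
      (∀ b' ∈ selmerGroup W (m : ℤ), sumPairing W m e hμ hadd₁ hadd₂ hgal inv S x (locS W m S b') = 0) →
        ∃ b₀ ∈ kummerOutside W m S, ∀ v : S,
          x v - locS W m S b₀ v ∈ W.kummerLocalConditionAt (m : ℤ) (Place.Completion (v : Place K))) :
    ∃ B : AddSubgroup.torsionBy W.sha m →+ AddSubgroup.torsionBy W.sha m →+ AddCircle (1 : ℚ), IsLevelPairing m B :=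
  ⟨_, isLevelPairing_ctLevelPairing_of_inputs_alt halt inv hPT' hH3 hPTc S₀ h615⟩

end

/-! ### The Cassels–Tate fact from its remaining (`p`-generic) inputs -/

section Fact

variable {K : Type u} [Field K] [NumberField K]

/-- **`WeierstrassCurve.exists_casselsTate_pairing` from its remaining inputs, alternation discharged**: the
tree's `exists_casselsTate_pairing_of_inputs` with the last conjunct (Cassels' alternation on `Ш[q]`) removed
from the hypothesis — it is the theorem `ctGeneralFun_self_eq_zero`.  What separates the tree from the
Cassels–Tate fact is now exactly: local invariant maps `inv` at level `q²` with reciprocity, `Ш³(K, μ_{q²}) = 0`,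
the Poitou–Tate criterion for `Ш²(K, E[q])`, and Lemma 6.15. [cite: MilneADT2006, Ch. I §6, Thm. 6.13(a) and Prop. 6.9]
[cite: Cassels1962ArithmeticIV, §1 (alternation)] -/
theorem exists_casselsTate_pairing_of_inputs_alt
    (h : ∀ (W : WeierstrassCurve K) [W.IsElliptic] (q : ℕ) [NeZero q]
      (e : geomTorsion W ((q * q : ℕ) : ℤ) → geomTorsion W ((q * q : ℕ) : ℤ) → AlgebraicClosure K)
      (hμ : ∀ S T, e S T ^ (q * q) = 1)
      (hadd₁ : ∀ S₁ S₂ T, e (S₁ + S₂) T = e S₁ T * e S₂ T)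
      (hadd₂ : ∀ S T₁ T₂, e S (T₁ + T₂) = e S T₁ * e S T₂)
      (hgal : ∀ (σ : absoluteGaloisGroup K) (S T : geomTorsion W ((q * q : ℕ) : ℤ)),
        σ • e S T = e (σ • S) (σ • T)),
      (∀ T, e T T = 1) → (∀ T, (∀ S, e S T = 1) → T = 0) → (∃ p k : ℕ, p.Prime ∧ 0 < k ∧ q = p ^ k) →
      ∃ (inv : LocalInvariants K (q * q)) (_ : inv.SumInvLocalizationEqZero)
        (_ : ∀ c : galoisCohomology (mu K (q * q)) 3,
          (∀ v : Place K, galoisCohomology.localization (mu K (q * q)) v 3 c = 0) → c = 0)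
        (S₀ : Finset (Place K)),
        (∀ f : contTwoCocycles (W.torsionGaloisModule (q : ℤ)).toTopRep,
          (∀ g : contOneCocycles (W.torsionGaloisModule (q : ℤ)).toTopRep,
            (∀ v : Place K, locClass (W.torsionGaloisModule (q : ℤ)) (Place.Completion v)
              (resOne (W.torsionGaloisModule (q : ℤ)) (Place.Completion v) g) = 0) →
            ∃ (C : PTChoice W q e hμ hadd₁ hadd₂ hgal f g) (S : Finset (Place K)),
              (∀ v ∉ S, C.localTerm inv v = 0) ∧ ∑ v ∈ S, C.localTerm inv v = 0) →
          twoCocycleClass _ f = 0) ∧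
        (∀ S : Finset (Place K), S₀ ⊆ S → ∀ x : LocalClasses W q S,
          (∀ b' ∈ selmerGroup W (q : ℤ), sumPairing W q e hμ hadd₁ hadd₂ hgal inv S x (locS W q S b') = 0) →
            ∃ b₀ ∈ kummerOutside W q S, ∀ v : S,
              x v - locS W q S b₀ v ∈ W.kummerLocalConditionAt (q : ℤ) (Place.Completion (v : Place K)))) :
    exists_casselsTate_pairing (K := K) := by
  refine exists_casselsTate_pairing_of_levelwise fun W _ p k hp hk => ?_
  haveI : NeZero (p ^ k) := ⟨pow_ne_zero k hp.ne_zero⟩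
  -- the Weil pairing at level `q² = p^k · p^k`
  have h2 : 2 ≤ p ^ k * p ^ k :=
    le_trans hp.two_le (le_trans (Nat.le_self_pow hk.ne' p) (Nat.le_mul_of_pos_right _ (NeZero.pos (p ^ k))))
  have hq : ((p ^ k * p ^ k : ℕ) : K) ≠ 0 := Nat.cast_ne_zero.mpr (NeZero.ne (p ^ k * p ^ k))
  obtain ⟨e, hμ, hadd₁, hadd₂, halt, hnd, hgal⟩ := exists_weilPairing_holds W (p ^ k * p ^ k) h2 hq
  obtain ⟨inv, hPT', hH3, S₀, hPTc, h615⟩ := h W (p ^ k) e hμ hadd₁ hadd₂ hgal halt hnd ⟨p, k, hp, hk, rfl⟩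
  exact exists_isLevelPairing_of_inputs_alt halt inv hPT' hH3 hPTc S₀ h615

end Fact

end Literature.NumberTheory.EllipticCurves

end
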